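import Summits.CriticalPhenomena.PercolationContinuityZ3.Theorems.Transplant.SkelFrmBChoiceRootRun
import Summits.CriticalPhenomena.PercolationContinuityZ3.Theorems.Transplant.SkelFrmBChoiceRootRunY
import HarnessLib

/-!
# N2 (frames-only node `SamePDropOfSkeletonFrm₁`, OPEN), (R) column — **THE DEPTH ROWS' REACH, TRANSFERRED FROM (C) TO THE ROOT** (both axes):
# `Skelφ.KGRows.kgZ₁_le_add_of_le` (cell-free: `Z₁(N) ≤ Z₁(N′) + dec₁ − 1` for `N ≤ N′` — `E₁` is the only non-monotone term),
# `KS.reachR1_le` (first axis: `13·((N_R+1)n_L + Z₀(N_R) + Z₁(N_R)) ≤ Z + 13·sL` whenever (C)'s `13·((kgNv0+1)n_L + Z₀ + Z₁) ≤ Z`, e.g. `Z := ZD2`),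
# `KS.reachRY_le` (second axis: `13·((N+1)P + ZY₀^R + ZY₁^R) ≤ Z + 13·n_L` whenever (C)'s `13·((N+1)P + ZY₀^C + ZY₁^C) ≤ Z` at `N = kgNYv0`,
# e.g. `Z := ZDYW`) — the skeletons' `hRD`/`hRD₃` N-parts; the ex-floors become `D0s + ZD2 + 13·sL + 1 ≤ ex`, `D2R + ZDYW + 13·n_L + 1 ≤ ex`.
builds on p205010 (kernel theorem, internal audit signed; external expert review pending) — nothing in this file uses p205010; nothing here is a
claim about the open node `SamePDropOfSkeletonFrm₁`.
Lane `prim-bschramm`, seat `prim-bschramm-p3` (gen 17; (R) lineage); helper file (`--supports stmt-CriticalPhenomena-4575 --as helper`).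
[cite: KozmaNitzan2024, §4 Lemma 12 (pp. 23–25), p. 28 ((32) at the root)]
-/

noncomputable section

open scoped Classical

namespace Summit.CriticalPhenomena.PercolationContinuityZ3.Theorems.Transplant

namespace Skelφ

section ZMono

variable {n ℓ : ℕ} {hs v : ℤ} {R' ρ q W : ℕ}

/-- **`Z₁(N) ≤ Z₁(N′) + dec₁ − 1` for `N ≤ N′`** (`A₁`, `m₁`, `m₂` are monotone; `Wm₂ + Wp₂ = E₁ ∈ [2P, 2P + dec₁)` at both). [this work] -/
theorem KGRows.kgZ₁_le_add_of_le (H : KGRows n ℓ hs v R' ρ q W) {N N' : ℕ} (h : N ≤ N') :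
    kgZ₁ n ℓ hs R' ρ W N (kgM₁ n ℓ hs R' ρ W N) (kgWm₂ n ℓ hs R' ρ W N) (kgWp₂ n ℓ hs R' ρ W N) (kgM₂ n ℓ hs v R' ρ q W N) ≤
      kgZ₁ n ℓ hs R' ρ W N' (kgM₁ n ℓ hs R' ρ W N') (kgWm₂ n ℓ hs R' ρ W N') (kgWp₂ n ℓ hs R' ρ W N') (kgM₂ n ℓ hs v R' ρ q W N') +
        kgDec₁ n ℓ hs R' ρ - 1 := by
  obtain ⟨-, -, hE⟩ := H.kgE₁_spec N
  obtain ⟨-, hE', -⟩ := H.kgE₁_spec N'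
  have hs1 : ((kgWm₂ n ℓ hs R' ρ W N : ℕ) : ℤ) + (kgWp₂ n ℓ hs R' ρ W N : ℕ) = (kgE₁ n ℓ hs R' ρ W N : ℕ) := by
    exact_mod_cast kgWm₂_add_kgWp₂ (n := n) (ℓ := ℓ) (hs := hs) (R' := R') (ρ := ρ) (W := W) N
  have hs2 : ((kgWm₂ n ℓ hs R' ρ W N' : ℕ) : ℤ) + (kgWp₂ n ℓ hs R' ρ W N' : ℕ) = (kgE₁ n ℓ hs R' ρ W N' : ℕ) := by
    exact_mod_cast kgWm₂_add_kgWp₂ (n := n) (ℓ := ℓ) (hs := hs) (R' := R') (ρ := ρ) (W := W) N'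
  have hA : kgA₁ n ℓ hs R' W N ≤ kgA₁ n ℓ hs R' W N' := kgA₁_mono n ℓ hs R' W h
  have hA' : ((kgA₁ n ℓ hs R' W N : ℕ) : ℤ) ≤ (kgA₁ n ℓ hs R' W N' : ℕ) := by exact_mod_cast hA
  have hm₁ : ((kgM₁ n ℓ hs R' ρ W N : ℕ) : ℤ) ≤ (kgM₁ n ℓ hs R' ρ W N' : ℕ) := by exact_mod_cast H.kgM₁_mono h
  have hm₂ : ((kgM₂ n ℓ hs v R' ρ q W N : ℕ) : ℤ) ≤ (kgM₂ n ℓ hs v R' ρ q W N' : ℕ) := by exact_mod_cast H.kgM₂_mono h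
  unfold kgZ₁
  have hR : (0 : ℤ) ≤ R' := by positivity
  have hρ : (0 : ℤ) ≤ ρ := by positivity
  nlinarith

end ZMono

end Skelφ

namespace PlanarSkeletonFrm

namespace NegB

open Literature.Probability.Percolation Literature.Probability.LatticeModels SimpleGraph
open SkelConc (Consts)
open Skelφ (shearUnit kgSL kgSLY KGRows KGYRows kgM₁ kgM₂ kgWm₂ kgWp₂ kgZ₀ kgZ₁ kgM₁Y kgM₂Y kgWm₂Y kgWp₂Y kgZY₀ kgZY₁ kgDec₁ kgDec₁Y)
open Neg

namespace KS

section DepthR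

variable (κ : Consts) {V : Type} [DecidableEq V] [Countable V] {G : SimpleGraph V} [G.LocallyFinite] (Φ : PlanarSkeletonFrm G) (t : V) (p : unitInterval)
  (D : Skelφ.StepI.DataNS V) (mk g f qx Wx qxY WxY : ℕ)

/-- **FIRST AXIS**: the root's reach `13·((N_R+1)n_L + Z₀(N_R) + Z₁(N_R))` is at most (C)'s reach bound `Z` plus `13·sL` (`dec₁ ≤ sL`). [this work] -/
theorem reachR1_le (hN : EqNumL κ Φ t p D g f) (hg : gFloorKG κ Φ t p D mk ≤ g) (hg2 : 40 * Neg.K κ * KS0.R'0 κ Φ t p D mk ≤ g)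
    (hqx : qx ≤ 100 * nL κ Φ t p D g f) (hWx : (Wx : ℤ) ≤ 20 * (kgSL (nL κ Φ t p D g f) (ℓL κ Φ t p D g f) (hL κ Φ t p D g f))) (hf : KS.fxR0 κ Φ t p D mk ≤ f) (Z : ℤ)
    (hC : 13 * ((((((kgNv0 κ Φ t p D g f mk qx Wx) : ℕ)) : ℤ) + 1) * (nL κ Φ t p D g f : ℤ) + (kgZ₀ (nL κ Φ t p D g f) (vL κ Φ t p D g f) (kgR κ Φ t p D mk) 0 (kgq κ Φ t p D g f qx) (kgNv0 κ Φ t p D g f mk qx Wx) (kgM₁ (nL κ Φ t p D g f) (ℓL κ Φ t p D g f) (hL κ Φ t p D g f) (kgR κ Φ t p D mk) 0 (kgW κ Φ t p D g f Wx) (kgNv0 κ Φ t p D g f mk qx Wx)) (kgM₂ (nL κ Φ t p D g f) (ℓL κ Φ t p D g f) (hL κ Φ t p D g f) (vL κ Φ t p D g f) (kgR κ Φ t p D mk) 0 (kgq κ Φ t p D g f qx) (kgW κ Φ t p D g f Wx) (kgNv0 κ Φ t p D g f mk qx Wx))) + (kgZ₁ (nL κ Φ t p D g f) (ℓL κ Φ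 t p D g f) (hL κ Φ t p D g f) (kgR κ Φ t p D mk) 0 (kgW κ Φ t p D g f Wx) (kgNv0 κ Φ t p D g f mk qx Wx) (kgM₁ (nL κ Φ t p D g f) (ℓL κ Φ t p D g f) (hL κ Φ t p D g f) (kgR κ Φ t p D mk) 0 (kgW κ Φ t p D g f Wx) (kgNv0 κ Φ t p D g f mk qx Wx)) (kgWm₂ (nL κ Φ t p D g f) (ℓL κ Φ t p D g f) (hL κ Φ t p D g f) (kgR κ Φ t p D mk) 0 (kgW κ Φ t p D g f Wx) (kgNv0 κ Φ t p D g f mk qx Wx)) (kgWp₂ (nL κ Φ t p D g f) (ℓL κ Φ t p D g f) (hL κ Φ t p D g f) (kgR κ Φ t p D mk) 0 (kgW κ Φ t p D g f Wx) (kgNv0 κ Φ t p D g f mk qx Wx)) (kgM₂ (nL κ Φ t p D g f) (ℓL κ Φ t p D g f) (hL κ Φ t p D g f) (vL κ Φ t p D g f) (kgR κ Φ t p D mk) 0 (kgq κ Φ t p D g f qx) (kgW κ Φ t p D g f Wx) (kgNv0 κ Φ t p D g f mk qx Wx)))) ≤ Z) :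
    13 * ((((((KS.kgNR κ Φ t p D mk g f qx Wx) : ℕ)) : ℤ) + 1) * (nL κ Φ t p D g f : ℤ) + (kgZ₀ (nL κ Φ t p D g f) (vL κ Φ t p D g f) (kgR κ Φ t p D mk) 0 (kgq κ Φ t p D g f qx) (KS.kgNR κ Φ t p D mk g f qx Wx) (kgM₁ (nL κ Φ t p D g f) (ℓL κ Φ t p D g f) (hL κ Φ t p D g f) (kgR κ Φ t p D mk) 0 (kgW κ Φ t p D g f Wx) (KS.kgNR κ Φ t p D mk g f qx Wx)) (kgM₂ (nL κ Φ t p D g f) (ℓL κ Φ t p D g f) (hL κ Φ t p D g f) (vL κ Φ t p D g f) (kgR κ Φ t p D mk) 0 (kgq κ Φ t p D g f qx) (kgW κ Φ t p D g f Wx) (KS.kgNR κ Φ t p D mk g f qx Wx))) + (kgZ₁ (nL κ Φ t p D g f) (ℓL κ Φ t p D g f) (hL κ Φ t p D g f) (kgR κ Φ t p D mk) 0 (kgW κ Φ t p D g f Wx) (KS.kgNR κ Φ t p D mk g f qx Wx) (kgM₁ (nL κ Φ t p D g f) (ℓL κ Φ t p D g f) (hL κ Φ t p D g f) (kgR κ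 Φ t p D mk) 0 (kgW κ Φ t p D g f Wx) (KS.kgNR κ Φ t p D mk g f qx Wx)) (kgWm₂ (nL κ Φ t p D g f) (ℓL κ Φ t p D g f) (hL κ Φ t p D g f) (kgR κ Φ t p D mk) 0 (kgW κ Φ t p D g f Wx) (KS.kgNR κ Φ t p D mk g f qx Wx)) (kgWp₂ (nL κ Φ t p D g f) (ℓL κ Φ t p D g f) (hL κ Φ t p D g f) (kgR κ Φ t p D mk) 0 (kgW κ Φ t p D g f Wx) (KS.kgNR κ Φ t p D mk g f qx Wx)) (kgM₂ (nL κ Φ t p D g f) (ℓL κ Φ t p D g f) (hL κ Φ t p D g f) (vL κ Φ t p D g f) (kgR κ Φ t p D mk) 0 (kgq κ Φ t p D g f qx) (kgW κ Φ t p D g f Wx) (KS.kgNR κ Φ t p D mk g f qx Wx)))) ≤ Z + 13 * (kgSL (nL κ Φ t p D g f) (ℓL κ Φ t p D g f) (hL κ Φ t p D g f)) := by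
  have H := kgRows0_of κ Φ t p D g f mk qx Wx hN hg
  have hle := kgNR_le_kgNv0 κ Φ t p D mk g f qx Wx hN hg hg2 hqx hWx hf
  obtain ⟨hZ₀, -⟩ := reachR_le κ Φ t p D mk g f qx Wx hN hg hg2 hqx hWx hf
  have hZ₁ := H.kgZ₁_le_add_of_le hle
  have hd : kgDec₁ (nL κ Φ t p D g f) (ℓL κ Φ t p D g f) (hL κ Φ t p D g f) (kgR κ Φ t p D mk) 0 ≤ (kgSL (nL κ Φ t p D g f) (ℓL κ Φ t p D g f) (hL κ Φ t p D g f)) := by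
    unfold kgDec₁; have : (0 : ℤ) ≤ (((kgR κ Φ t p D mk) : ℕ) : ℤ) := by positivity
    push_cast; linarith
  linarith

/-- **SECOND AXIS**: the root y′-corridor's reach `13·((N+1)P + ZY₀^R + ZY₁^R)` at `N = kgNYv0` is at most (C)'s reach bound `Z` plus `13·n_L`
(`ZY₀^R ≤ ZY₀^C + dec₁Y − 1`, `ZY₁^R ≤ ZY₁^C`, `dec₁Y ≤ n_L`). [this work] -/
theorem reachRY_le (hN : EqNumL κ Φ t p D g f) (hg : gFloorKG κ Φ t p D mk ≤ g) (Z : ℤ)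
    (hC : 13 * ((((((kgNYv0 κ Φ t p D g f mk qxY WxY) : ℕ)) : ℤ) + 1) * ((((nL κ Φ t p D g f) * (ℓL κ Φ t p D g f) / Skelφ.shearUnit (nL κ Φ t p D g f) (hL κ Φ t p D g f) + 1 : ℕ)) : ℤ) + (kgZY₀ (nL κ Φ t p D g f) (vL κ Φ t p D g f) (kgR κ Φ t p D mk) 0 (kgWY κ Φ t p D g f WxY) (kgNYv0 κ Φ t p D g f mk qxY WxY) (kgM₁Y (nL κ Φ t p D g f) (vL κ Φ t p D g f) (kgR κ Φ t p D mk) 0 (kgWY κ Φ t p D g f WxY) (kgNYv0 κ Φ t p D g f mk qxY WxY)) (kgWm₂Y (nL κ Φ t p D g f) (vL κ Φ t p D g f) (kgR κ Φ t p D mk) 0 (kgWY κ Φ t p D g f WxY) (kgNYv0 κ Φ t p D g f mk qxY WxY)) (kgWp₂Y (nL κ Φ t p D g f) (vL κ Φ t p D g f) (kgR κ Φ t p D mk) 0 (kgWY κ Φ t p D g f WxY) (kgNYv0 κ Φ t p D g f mk qxY WxY)) (kgM₂Y (nL κ Φ t p D g f) (ℓL κ Φ t p D g f) (hL κ Φ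 t p D g f) (vL κ Φ t p D g f) (kgR κ Φ t p D mk) 0 (kgqY κ Φ t p D g f qxY) (kgWY κ Φ t p D g f WxY) (kgNYv0 κ Φ t p D g f mk qxY WxY))) + (kgZY₁ (nL κ Φ t p D g f) (ℓL κ Φ t p D g f) (hL κ Φ t p D g f) (kgR κ Φ t p D mk) 0 (kgqY κ Φ t p D g f qxY) (kgNYv0 κ Φ t p D g f mk qxY WxY) (kgM₁Y (nL κ Φ t p D g f) (vL κ Φ t p D g f) (kgR κ Φ t p D mk) 0 (kgWY κ Φ t p D g f WxY) (kgNYv0 κ Φ t p D g f mk qxY WxY)) (kgM₂Y (nL κ Φ t p D g f) (ℓL κ Φ t p D g f) (hL κ Φ t p D g f) (vL κ Φ t p D g f) (kgR κ Φ t p D mk) 0 (kgqY κ Φ t p D g f qxY) (kgWY κ Φ t p D g f WxY) (kgNYv0 κ Φ t p D g f mk qxY WxY)))) ≤ Z) :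
    13 * ((((((kgNYv0 κ Φ t p D g f mk qxY WxY) : ℕ)) : ℤ) + 1) * ((((nL κ Φ t p D g f) * (ℓL κ Φ t p D g f) / Skelφ.shearUnit (nL κ Φ t p D g f) (hL κ Φ t p D g f) + 1 : ℕ)) : ℤ) + (kgZY₀ (nL κ Φ t p D g f) (vL κ Φ t p D g f) (kgR κ Φ t p D mk) 0 (kgWY κ Φ t p D g f (KS.WxYR κ Φ t p D mk g f WxY)) (kgNYv0 κ Φ t p D g f mk qxY WxY) (kgM₁Y (nL κ Φ t p D g f) (vL κ Φ t p D g f) (kgR κ Φ t p D mk) 0 (kgWY κ Φ t p D g f (KS.WxYR κ Φ t p D mk g f WxY)) (kgNYv0 κ Φ t p D g f mk qxY WxY)) (kgWm₂Y (nL κ Φ t p D g f) (vL κ Φ t p D g f) (kgR κ Φ t p D mk) 0 (kgWY κ Φ t p D g f (KS.WxYR κ Φ t p D mk g f WxY)) (kgNYv0 κ Φ t p D g f mk qxY WxY)) (kgWp₂Y (nL κ Φ t p D g f) (vL κ Φ t p D g f) (kgR κ Φ t p D mk) 0 (kgWY κ Φ t p D g f (KS.WxYR κ Φ t p D mk g f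 WxY)) (kgNYv0 κ Φ t p D g f mk qxY WxY)) (kgM₂Y (nL κ Φ t p D g f) (ℓL κ Φ t p D g f) (hL κ Φ t p D g f) (vL κ Φ t p D g f) (kgR κ Φ t p D mk) 0 (kgqY κ Φ t p D g f qxY) (kgWY κ Φ t p D g f (KS.WxYR κ Φ t p D mk g f WxY)) (kgNYv0 κ Φ t p D g f mk qxY WxY))) + (kgZY₁ (nL κ Φ t p D g f) (ℓL κ Φ t p D g f) (hL κ Φ t p D g f) (kgR κ Φ t p D mk) 0 (kgqY κ Φ t p D g f qxY) (kgNYv0 κ Φ t p D g f mk qxY WxY) (kgM₁Y (nL κ Φ t p D g f) (vL κ Φ t p D g f) (kgR κ Φ t p D mk) 0 (kgWY κ Φ t p D g f (KS.WxYR κ Φ t p D mk g f WxY)) (kgNYv0 κ Φ t p D g f mk qxY WxY)) (kgM₂Y (nL κ Φ t p D g f) (ℓL κ Φ t p D g f) (hL κ Φ t p D g f) (vL κ Φ t p D g f) (kgR κ Φ t p D mk) 0 (kgqY κ Φ t p D g f qxY) (kgWY κ Φ t p D g f (KS.WxYR κ Φ t p D mk g f WxY)) (kgNYv0 κ Φ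 t p D g f mk qxY WxY)))) ≤ Z + 13 * (nL κ Φ t p D g f : ℤ) := by
  obtain ⟨hZ₀, hZ₁⟩ := ZY_R_le κ Φ t p D mk g f qxY WxY hN hg (kgNYv0 κ Φ t p D g f mk qxY WxY)
  have hd : kgDec₁Y (nL κ Φ t p D g f) (kgR κ Φ t p D mk) 0 ≤ (nL κ Φ t p D g f : ℤ) := by
    unfold kgDec₁Y; have : (0 : ℤ) ≤ (((kgR κ Φ t p D mk) : ℕ) : ℤ) := by positivity
    push_cast; linarith
  linarith

end DepthR

end KS

end NegB

end PlanarSkeletonFrm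

end Summit.CriticalPhenomena.PercolationContinuityZ3.Theorems.Transplant

end
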